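import Summits.ABC.IUTFork.Conditional.Layer4OfS
import Summits.ABC.IUTFork.Conditional.Layer4OfSa14
import Summits.ABC.IUTFork.Conditional.Layer4OfSb13
import HarnessLib

/-!
# L4 layer certificate — TOP MODULE v14 (`Layer4Residual14` etc.): continuation of `Conditional/Layer4OfS.lean`

abc-iut cell; CERT-L4 lineage (seat abc-iut-w6-d032 v0–v3, abc-iut-w6-d071 v4–v9, abc-iut-c312-2 v10–v13). The historical top file
`Conditional/Layer4OfS.lean` (v0–v13 records, APPEND-ONLY) reached the tree's 400-line cap with the v13 append (p520755, 397 lines), so from v14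
on the CURRENT apex binder lives in THIS module, which imports that file unchanged (every earlier `Layer4Residual<j>` stays a record there) plus
the v14 part A `Conditional/Layer4OfSa14.lean` and the UNCHANGED v13 part B `Conditional/Layer4OfSb13.lean` (status = plan/DAG.tsv 11:03:14Z + the L4 lead's countersigned overlay + GO m227 11:13:04Z / m226: Cor5.10(iv) r → d, Cor5.5(iii) d_data → d via the index claim sibling `N_AbsTopIII_Cor5_5_iii'` (p527580); standing strikes Thm2.6(vi) (m203) and Lem2.5(ii) / Prop4.10(ii) / Thm2.6(i) / Cor1.10(iii) (m213) stay residual; only part A moved (v14 part A `Conditional/Layer4OfSa14.lean`), part B is the UNCHANGED v13 `Conditional/Layer4OfSb13.lean`). Same four names and shapes as every earlier version. COUNT v14: L4 cone 143 = d 85 (A 68 + B 17; d_idx R-def (b) Definition rows inside, COUNT-NEUTRAL in the L4 book) + r 19 (A 8 + B 11) + d_data 39 (A 29 + B 10) + not-indexed 0; 85 + 19 + 39 = 143 (v13: 83 + 20 + 40); L4 claim-node COUNT of record 102 (different universe).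
THIS FILE PROVES NOTHING NEW: `Layer4Residual14` / `Layer4Discharged14` are conjunctions of the parts' Props BY NAME; the two theorems are the
tuples of the parts' theorems. HONEST FRAMING: bookkeeping of the NODES status BY NAME; witnessed ≠ lead-discharged; indexed ≠ endorsed; no side
taken on [IUTchIII] Cor. 3.12; nothing here says abc is proved or refuted. [claim: Mochizuki2012, status: disputed] (node texts).
-/

namespace Summit.ABC.IUTFork.Conditional

/-- **L4 residual, v14** (CURRENT) = `Layer4ResidualA14` ∧ `Layer4ResidualB13` — the ONE binder the apex takes for L4 at v14. [claim: Mochizuki2012, status: disputed] -/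
def Layer4Residual14.{u₁, u₂, u₃} : Prop :=
  Layer4ResidualA14.{u₁} ∧ Layer4ResidualB13.{u₁, u₂, u₃}

/-- **L4 discharged, v14** = `Layer4DischargedA14` ∧ `Layer4DischargedB13` (DAG-discharged + lead-countersigned claim nodes of both parts), a kernel
theorem by the parts' witnesses BY NAME. [claim: Mochizuki2012, status: disputed] -/
def Layer4Discharged14.{u₁, u₂, u₃, u₄} : Prop :=
  Layer4DischargedA14.{u₁, u₂, u₃, u₄} ∧ Layer4DischargedB13.{u₁, u₂, u₃}

/-- `Layer4Discharged14` holds (both halves are proved in the parts; nothing new here). [claim: Mochizuki2012, status: disputed] -/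
theorem layer4Discharged14_holds.{u₁, u₂, u₃, u₄} : Layer4Discharged14.{u₁, u₂, u₃, u₄} :=
  ⟨layer4DischargedA14_holds, layer4DischargedB13_holds⟩

/-- **The whole L4 slice of the Cor. 3.12 cone at v14 from its residual alone**: `Layer4Residual14 → Layer4ConeA14 ∧ Layer4ConeB13`.
[claim: Mochizuki2012, status: disputed] -/
theorem layer4Cone14_of.{u₁, u₂, u₃, u₄} (h : Layer4Residual14.{u₁, u₂, u₃}) :
    Layer4ConeA14.{u₁, u₂, u₃, u₄} ∧ Layer4ConeB13.{u₁, u₂, u₃} :=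
  ⟨layer4ConeA14_of h.1, layer4ConeB13_of h.2⟩

end Summit.ABC.IUTFork.Conditional
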